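import Summits.BirchSwinnertonDyer.BirchSwinnertonDyer.Theorems.SignedLowerHalvesKobayashiMainConjectureSmallImageCMTransferRecordsA
import HarnessLib

/-!
# Route `SignedLowerHalves`, crux `KobayashiMainConjectureSmallImage` (item stmt-BirchSwinnertonDyer-19002) —
# the CM-congruence transfer line (L4-CM), part H: the per-pair record for `26352o1 @ 5` (the A7 theorem-needed
# rank-0 class at `p = 5`) from its RANK-1 CM partner `y² = x³ − 4`, with the μ-binder DISPLAYED
# (cell `bsd-ssimc`, seat `bsd-ssimc-k3-c4` gen 2)

HONEST FRAMING: Kobayashi's signed main conjecture at a non-surjective image is OPEN; nothing here proves it for any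
class. The record is CONDITIONAL on (1) the explicitly labelled OPEN binder `CorpuzLei2025_signedMainConjecture_transfer_OPEN`
(Corpuz–Lei arXiv:2508.09733, 2025, UNREFEREED preprint; hypothesis `hCL`, never asserted), (2) PUBLISHED results BY
NAME (`hPR` Pollack–Rubin 2004, `h5`/`h3` period units, `hF` Fisher 2012 Thm. 13.2), and (3) a DISPLAYED NON-KERNEL
binder `hμ'`: unit content of Kobayashi's `L_5^±` of the partner `E' : y² = x³ − 4` (conductor `432`, analytic rank `1` —
NOT the unit case of part A; `μ^±(E') = 0` is a two-engine CERTIFICATE, kit j251201: PARI `ellpadiclambdamu` and the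
cell's PARI-free modular-symbol engine agree, see the theorem's docstring), exactly the `hμ'` of the tree's class
consumer `kobayashiMainConjecture_of_cmPartner_of_transfer_OPEN` (p422273). Kernel-decided: both models elliptic and
minimal, `5 ∤ Δ` on both, `#Ẽ(𝔽_5) = #Ẽ'(𝔽_5) = 6` (`a_5 = 0`), `j(E') = 0` (CM), and the congruence `E[5] ≃ E'[5]`:
`E` is `ℚ`-isomorphic to the member `(λ:μ) = (−48:1)` of the Hesse pencil `X_{E'}(5)` (`fiveCongruent_of_hesseCertificate`,
scaling `u = 31850496`, the two covariant identities by `norm_num` on the tree's closed forms; modulo `hF`). With part A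
(`55648b1 @ 3`) BOTH rank-0 classes of board A7 that TARGET §6.0b lists as «theorem needed» now carry a per-pair
statement of Kobayashi's ± MC modulo the PRE binder (this one with one μ-certificate binder). Per pair; item 4 stays
OPEN; nothing is booked; BSD is not proved by any of this.

References: [CorpuzLei2025] Thms 1–3; [PollackRubin2004] Thm. (p. 448); [Kobayashi2003] Conj. (p. 2); [GreenbergVatsal2000]
(2), §3 Rem. 3.4; [Fisher2012Hessian] §8, Thm. 13.2; [SilvermanAEC2009] III §1, VII.1, App. C §11; [Cremona2006] Table 1
(label 26352o1).
-/

set_option autoImplicit false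
set_option linter.dupNamespace false

noncomputable section

open scoped Classical MatrixGroups ModularForm

open CongruenceSubgroup WeierstrassCurve Literature.NumberTheory.EllipticCurves
  Literature.NumberTheory.EllipticCurves.ModularForms
  Literature.NumberTheory.EllipticCurves.Kobayashi2003 ZpExtension
  Literature.NumberTheory.EllipticCurves.GreenbergVatsal2000
  Literature.NumberTheory.EllipticCurves.Rank1Residual
  Literature.NumberTheory.EllipticCurves.Rank1Residual.Typed
  Literature.NumberTheory.EllipticCurves.Rank1Residual.X11RankOneCertificates
  Literature.NumberTheory.EllipticCurves.Fisher2012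
  Summit.BirchSwinnertonDyer.BirchSwinnertonDyer.Rank1Residual.IntModel
  Summit.BirchSwinnertonDyer.BirchSwinnertonDyer.Rank1Residual.X11RankOne
  Summit.BirchSwinnertonDyer.Rank1Residual.X11b
  Summit.BirchSwinnertonDyer.Rank1Residual.X9
  Summit.BirchSwinnertonDyer.Rank1Residual.X1
  Summit.BirchSwinnertonDyer.Rank1Residual.Supersingular

namespace Summit.BirchSwinnertonDyer.BirchSwinnertonDyer.Theorems

/-- `#{Ẽ'(𝔽_5)} = 6` for the CM partner `[0,0,0,0,-4] : y² = x³ − 4` (`j = 0`) (`a_5 = 0`: good SUPERSINGULAR; kernel count). [folklore] -/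
theorem card_cm0m4_5 :
    Nat.card (((⟨0, 0, 0, 0, -4⟩ : WeierstrassCurve ℤ).map
      (Int.castRingHom (ZMod 5))).toAffine.Point) = 6 := by
  rw [@WeierstrassCurve.natCard_point_eq_one_add_card (ZMod 5) (@ZMod.instField 5 ⟨by norm_num⟩) _ _ _
    (by decide +kernel), @card_sol_eq_sum_euler (ZMod 5) (@ZMod.instField 5 ⟨by norm_num⟩) _ _
    (by rw [ZMod.ringChar_zmod_n]; decide), ZMod.card]
  decide +kernel

/-- The CM partner `[0,0,0,0,-4] : y² = x³ − 4` (`j = 0`) is an elliptic curve (`Δ ≠ 0`, kernel). [folklore] -/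
theorem isElliptic_cm0m4 : (⟨0, 0, 0, 0, -4⟩ : WeierstrassCurve ℚ).IsElliptic :=
  isElliptic_of_discOf_ne_zero 0 0 0 0 (-4) (by decide +kernel)

/-- The CM partner `[0,0,0,0,-4] : y² = x³ − 4` (`j = 0`) is globally minimal (Kraus' bounded criterion, kernel). [cite: SilvermanAEC2009, VII.1 Remark 1.1] -/
theorem isGloballyMinimal_cm0m4 : (⟨0, 0, 0, 0, -4⟩ : WeierstrassCurve ℚ).IsGloballyMinimal :=
  isGloballyMinimal_of_krausCriterion_bounded₂ 0 0 0 0 (-4) (by decide +kernel) (by decide +kernel)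
    (by decide +kernel)

/-- The CM partner `[0,0,0,0,-4] : y² = x³ − 4` (`j = 0`) has CM (`j = 0 ∈` the thirteen CM values), for any globally minimal `A` with this
integral model. [cite: SilvermanAEC2009, App. C §11] -/
theorem hasCM_cm0m4 {A : WeierstrassCurve ℚ} [A.IsElliptic] [A.IsGloballyMinimal]
    (hIA : integralModelInt A = ⟨0, 0, 0, 0, -4⟩) : A.HasCM :=
  (hasCM_iff_j_mem_holds A).mpr (by rw [j_eq_of_intModel 0 0 0 0 (-4) hIA]; decide +kernel)

/-- `#{Ẽ(𝔽_5)} = 6` for the Cremona model of `26352o1` (`a_5 = 0`: good SUPERSINGULAR; kernel count).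
[cite: Cremona2006, Table 1 (Cremona label 26352o1)] -/
theorem card_c26352o1_5 :
    Nat.card (((⟨0, 0, 0, -4798545, 4045875099⟩ : WeierstrassCurve ℤ).map
      (Int.castRingHom (ZMod 5))).toAffine.Point) = 6 := by
  rw [@WeierstrassCurve.natCard_point_eq_one_add_card (ZMod 5) (@ZMod.instField 5 ⟨by norm_num⟩) _ _ _
    (by decide +kernel), @card_sol_eq_sum_euler (ZMod 5) (@ZMod.instField 5 ⟨by norm_num⟩) _ _
    (by rw [ZMod.ringChar_zmod_n]; decide), ZMod.card]
  decide +kernel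

/-- The Cremona model of `26352o1` is an elliptic curve (`Δ ≠ 0`, kernel). [cite: Cremona2006, Table 1 (Cremona label 26352o1)] -/
theorem isElliptic_c26352o1 : (⟨0, 0, 0, -4798545, 4045875099⟩ : WeierstrassCurve ℚ).IsElliptic :=
  isElliptic_of_discOf_ne_zero 0 0 0 (-4798545) 4045875099 (by decide +kernel)

/-- The Cremona model of `26352o1` is globally minimal (Kraus' bounded criterion, kernel). [cite: SilvermanAEC2009, VII.1 Remark 1.1] -/
theorem isGloballyMinimal_c26352o1 : (⟨0, 0, 0, -4798545, 4045875099⟩ : WeierstrassCurve ℚ).IsGloballyMinimal :=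
  isGloballyMinimal_of_krausCriterion_bounded₂ 0 0 0 (-4798545) 4045875099 (by decide +kernel) (by decide +kernel)
    (by decide +kernel)

/-- **Kobayashi's ± main conjecture, BOTH signs, for `26352o1 @ 5`** (Cremona model `[0, 0, 0, -4798545, 4045875099]`, `N = 26352 = 2⁴·3³·61`,
`r_an = 0`; item-4 pair: X7, `a_5 = 0`, image `5Nn`) **by CM-congruence transfer from the RANK-1 CM partner
`E' =` `[0,0,0,0,-4] : y² = x³ − 4` (`j = 0`) (conductor `432`), MODULO the OPEN binder `hCL` (Corpuz–Lei 2025, PRE) AND the displayed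
`μ`-BINDER `hμ'`** (unit content of `L_p^±(E')` — NOT a kernel fact; certificate: kit j251201 — engine A PARI `ellpadiclambdamu(E',5) = [[1, 1], [0, 0]]` (both μ = 0; λ^± = 1 odd, consistent with rank 1), engine B (the cell's PARI-free modular-symbol engine) Mazur–Tate layers: even-Pollack-index top n=3 μ=0 λ−q=1, odd top n=2 μ=0 λ−q=1 — two engines agree). `E ≅_ℚ` the member `(λ:μ) = (-48:1)` of `X_{E'}(5)`, `u = 31850496` (`fiveCongruent_of_hesseCertificate`, modulo Fisher 2012 Thm. 13.2 `hF`);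
covariant identities by `norm_num`. BY NAME: `hPR`, `h5`, `h3`, `hF`. Kernel-decided: ellipticity, minimality, `5 ∤ Δ` (both),
`#Ẽ(𝔽_5) = #Ẽ'(𝔽_5) = 6`, CM of `E'`. Per pair; item 4 stays OPEN; nothing booked.
[claim: CorpuzLei2025, status: under-review] [cite: PollackRubin2004, Theorem (p. 448) = Thm. 7.3]
[cite: Fisher2012Hessian, Thm. 13.2 (n = 5)] [cite: Cremona2006, Table 1 (Cremona label 26352o1)] -/
theorem kobayashiMainConjecture_c26352o1_5_of_mu_of_transfer_OPEN
    (hCL : CorpuzLei2025_signedMainConjecture_transfer_OPEN)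
    (hPR : PollackRubin2004.mainTheorem_signedCharIdeal_eq_of_cm)
    (h5 : realPeriodRat_eq_unit_mul_plusPeriod) (h3 : realPeriodRat_eq_unit_mul_plusPeriod_three)
    (hF : thm132_fiveCongruent_hessePencil)
    (W A : WeierstrassCurve ℚ) [W.IsElliptic] [W.IsGloballyMinimal] [A.IsElliptic] [A.IsGloballyMinimal]
    [Fact (Nat.Prime 5)] (hW : W = ⟨0, 0, 0, -4798545, 4045875099⟩) (hA : A = ⟨0, 0, 0, 0, -4⟩)
    (hμ' : ∀ [NeZero (A.conductorNorm ℤ)] (f' : CuspForm (Gamma0 (A.conductorNorm ℤ)) 2),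
      IsNewformOf A f' → ∀ (Lplus Lminus : IwasawaAlgebra 5), IsPollackPair f' 5 Lplus Lminus →
      ∀ ε : ℤˣ, HasUnitContent (kobayashiL ε Lplus Lminus)) (ε : ℤˣ) :
    KobayashiMainConjecture W 5 ε := by
  have hIW : integralModelInt W = ⟨0, 0, 0, -4798545, 4045875099⟩ :=
    integralModelInt_eq_of_map_eq _ (by rw [hW]; ext <;> simp [WeierstrassCurve.map])
  have hIA : integralModelInt A = ⟨0, 0, 0, 0, -4⟩ :=
    integralModelInt_eq_of_map_eq _ (by rw [hA]; ext <;> simp [WeierstrassCurve.map])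
  have hΔ : (⟨0, 0, 0, -4798545, 4045875099⟩ : WeierstrassCurve ℤ).Δ = discOf [0, 0, 0, -4798545, 4045875099] :=
    intCurve_Δ 0 0 0 (-4798545) 4045875099
  have hΔA : (⟨0, 0, 0, 0, -4⟩ : WeierstrassCurve ℤ).Δ = discOf [0, 0, 0, 0, -4] :=
    intCurve_Δ 0 0 0 0 (-4)
  have hgood : W.HasGoodReductionAtPrime 5 :=
    hasGoodReductionAtPrime_of_not_dvd W 5 (by rw [minimalDiscriminantInt_eq hIW, hΔ]; decide +kernel)
  have hgoodA : A.HasGoodReductionAtPrime 5 :=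
    hasGoodReductionAtPrime_of_not_dvd A 5 (by rw [minimalDiscriminantInt_eq hIA, hΔA]; decide +kernel)
  have hap : W.frobeniusTrace 5 = 0 := by rw [frobeniusTrace_eq hIW card_c26352o1_5]; norm_num
  have hapA : A.frobeniusTrace 5 = 0 := by rw [frobeniusTrace_eq hIA card_cm0m4_5]; norm_num
  have hc4 : W.c₄ = (230330160 : ℚ) := by
    subst hW; norm_num [WeierstrassCurve.c₄, WeierstrassCurve.b₂, WeierstrassCurve.b₄]
  have hc6 : W.c₆ = (-3495636085536 : ℚ) := by
    subst hW; norm_num [WeierstrassCurve.c₆, WeierstrassCurve.b₂, WeierstrassCurve.b₄, WeierstrassCurve.b₆]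
  have hc4A : A.c₄ = (0 : ℚ) := by
    subst hA; norm_num [WeierstrassCurve.c₄, WeierstrassCurve.b₂, WeierstrassCurve.b₄]
  have hc6A : A.c₆ = (3456 : ℚ) := by
    subst hA; norm_num [WeierstrassCurve.c₆, WeierstrassCurve.b₂, WeierstrassCurve.b₄, WeierstrassCurve.b₆]
  have hiso := fiveCongruent_of_hesseCertificate hF A W (-48 : ℚ) 1 (31850496 : ℚ)
    (by norm_num) (by rw [hc4A, hc6A, hc4, eval_hesseC4]; norm_num)
    (by rw [hc4A, hc6A, hc6, eval_hesseC6]; norm_num)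
  exact kobayashiMainConjecture_of_cmPartner_of_transfer_OPEN W A 5 hCL hPR h5 h3 (by norm_num) hgood hap
    (hasCM_cm0m4 hIA) ⟨hgoodA, by rw [hapA]; exact dvd_zero _⟩ hapA hiso hμ' ε

end Summit.BirchSwinnertonDyer.BirchSwinnertonDyer.Theorems

end
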